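/-
Copyright (c) 2026. All rights reserved.
Released under Apache 2.0 license as described in the file LICENSE.
-/
import Literature.Probability.FitznerVanDerHofstad2017.SrwKZeroTwoConeSup
import Literature.Probability.FitznerVanDerHofstad2017.SrwKappaPolyMinorant
import HarnessLib

/-!
# The `K_{0,2}` cone supremum `sup_{‖x‖₁ ≥ 2} K_{0,2}(x) = κ_d/(2d)` for every `d ≥ 7`

`SrwKZeroTwoConeSup.srwK_zero_two_le_kappa_div` has the hypothesis `10 ≤ d` only because its
Cauchy–Schwarz assembly feeds on Littlewood's `κ_d² ≥ 1/(3(2d-1))`. The assembly needs exactly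
`3(2d-1)/(4d²(d-1)) ≤ κ_d²` (`I_{0,4}(0)·L_0(y) ≤ I_{0,4}(0)/(2d(d-1)) = [3(2d-1)/(4d²(d-1))]/(2d)²` on the
multi-support cone), which `SrwKappaPolyMinorant.three_mul_div_le_srwK_zero_zero_single_sq` proves for every
`d ≥ 7` by a degree-8 polynomial minorant of `|t|`. Here:
* `srwK_zero_two_le_kappa_div_of_kappa_sq` — the assembly with the `κ_d²`-hypothesis (`d ≥ 2`);
* **`srwK_zero_two_le_kappa_div_of_seven_le (hd : 7 ≤ d) (x) (hx : 2 ≤ Σ|x_μ|) : K_{0,2}(x) ≤ κ_d/(2d)`**,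
  with equality on the axis family `m e_i`, `|m| ≥ 2` (`SrwTwoCosineInsertion.srwK_zero_two_single_eq_kappa_div`):
  `sup_{‖x‖₁ ≥ 2} K_{0,2}(x) = κ_d/(2d)` for every `d ≥ 7` (d-generic; no dimension-specific number).

What-if / input-certification lane of the b2b-lace packet: a d-generic SRW-integral statement; nothing here is a
certificate and no dimension-specific sentence is made.

Sources: Fitzner–van der Hofstad, *Mean-field behavior for nearest-neighbor percolation in d > 10*
[FitznerVanDerHofstad2016NoBLE], (3.36) p. 1071, (5.15)–(5.16) p. 1092, Lemma 5.1 and §5.1 p. 1093.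
-/

noncomputable section

open MeasureTheory Real Finset

namespace Literature.Probability.FitznerVanDerHofstad2017

open Literature.Barriers.CriticalPhenomena

section SupAssembly

variable {d : ℕ}

/-- **Assembly with the `κ_d²`-hypothesis**: for `d ≥ 2`, if `L_0(y) ≤ 1/(2d(d-1))` on the multi-support cone,
`I_{0,4}(0) = 3(2d-1)/(8d³)` and `κ_d² ≥ 3(2d-1)/(4d²(d-1))`, then `K_{0,2}(x) ≤ κ_d/(2d)` whenever
`Σ|x_μ| ≥ 2` (Cauchy–Schwarz on the cone: `I_{0,4}(0)·L_0(y) ≤ [3(2d-1)/(4d²(d-1))]/(2d)² ≤ κ_d²/(2d)²`;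
the axis family by `srwK_zero_two_le_of_kappa_of_multi`).
[cite: FitznerVanDerHofstad2016NoBLE, (5.15)–(5.16) p. 1092 and §5.1 p. 1093] -/
theorem srwK_zero_two_le_kappa_div_of_kappa_sq (hd : 2 ≤ d)
    (hL : ∀ y : Fin d → ℤ, 2 ≤ suppCount y → srwL d 0 y ≤ 1 / (2 * d * (d - 1)))
    (hI4 : srwI d 0 4 0 = 3 * (2 * d - 1) / (8 * d ^ 3))
    (hκ0 : 0 ≤ srwK d 0 0 (Pi.single (⟨0, by omega⟩ : Fin d) 1))
    (hκ : 3 * (2 * (d : ℝ) - 1) / (4 * (d : ℝ) ^ 2 * ((d : ℝ) - 1))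
      ≤ srwK d 0 0 (Pi.single (⟨0, by omega⟩ : Fin d) 1) ^ 2)
    (x : Fin d → ℤ) (hx : 2 ≤ ∑ j, |x j|) :
    srwK d 0 2 x ≤ srwK d 0 0 (Pi.single (⟨0, by omega⟩ : Fin d) 1) / (2 * d) := by
  set κ := srwK d 0 0 (Pi.single (⟨0, by omega⟩ : Fin d) 1) with hκdef
  have hd' : (2 : ℝ) ≤ d := by exact_mod_cast hd
  have hd1 : (0 : ℝ) < (d : ℝ) - 1 := by linarith
  have h2d1 : (0 : ℝ) < 2 * (d : ℝ) - 1 := by linarith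
  refine srwK_zero_two_le_of_kappa_of_multi (by omega) (κ / (2 * d)) le_rfl (fun y _ _ h2 _ => ?_) x hx
  have hcs := srwK_le_sqrt_srwI_mul_srwL (n := 0) (by omega) 2 y
  rw [show 2 * 2 = 4 from rfl, hI4] at hcs
  refine hcs.trans ?_
  rw [← Real.sqrt_mul (by positivity)]
  have hsq : κ / (2 * d) = Real.sqrt ((κ / (2 * d)) ^ 2) := by
    rw [Real.sqrt_sq (by positivity)]
  rw [hsq]
  apply Real.sqrt_le_sqrt
  have hLy := hL y h2
  calc 3 * (2 * (d : ℝ) - 1) / (8 * (d : ℝ) ^ 3) * srwL d 0 y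
      ≤ 3 * (2 * (d : ℝ) - 1) / (8 * (d : ℝ) ^ 3) * (1 / (2 * (d : ℝ) * ((d : ℝ) - 1))) := by
        gcongr
    _ = (3 * (2 * (d : ℝ) - 1) / (4 * (d : ℝ) ^ 2 * ((d : ℝ) - 1))) / (2 * (d : ℝ)) ^ 2 := by
        field_simp
        ring
    _ ≤ κ ^ 2 / (2 * (d : ℝ)) ^ 2 := by
        gcongr
    _ = (κ / (2 * (d : ℝ))) ^ 2 := by rw [div_pow]

end SupAssembly

end Literature.Probability.FitznerVanDerHofstad2017

end


noncomputable section

namespace Literature.Probability.FitznerVanDerHofstad2017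

open Finset MeasureTheory Real

variable {d : ℕ}

/-- **Exact supremum of `K_{0,2}` over `{‖x‖₁ ≥ 2}` (upper bound), every `d ≥ 7`**:
`K_{0,2}(x) ≤ κ_d/(2d)` for all `x ∈ ℤ^d` with `Σ|x_μ| ≥ 2`, where `κ_d = K_{0,0}(e_0)`; equality holds on
the whole axis family `m e_i`, `|m| ≥ 2` (`srwK_zero_two_single_eq_kappa_div`). Extends
`srwK_zero_two_le_kappa_div` (`d ≥ 10`) by the degree-8 minorant bound
`three_mul_div_le_srwK_zero_zero_single_sq`.
[cite: FitznerVanDerHofstad2016NoBLE, (5.15)–(5.16) p. 1092 and Lemma 5.1 p. 1093] -/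
theorem srwK_zero_two_le_kappa_div_of_seven_le (hd : 7 ≤ d) (x : Fin d → ℤ) (hx : 2 ≤ ∑ j, |x j|) :
    srwK d 0 2 x ≤ srwK d 0 0 (Pi.single (⟨0, by omega⟩ : Fin d) 1) / (2 * d) := by
  refine srwK_zero_two_le_kappa_div_of_kappa_sq (by omega) (fun y hy => ?_) (srwI_zero_four_zero (by omega))
    (srwK_nonneg 0 0 _) (three_mul_div_le_srwK_zero_zero_single_sq hd _) x hx
  exact srwL_zero_le_of_two_le_card_support (by omega) y hy

end Literature.Probability.FitznerVanDerHofstad2017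

end
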